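import Summits.NavierStokesRegularity.OSWSelfSimilar.SheetNSLineSchochetTwoPoleBlowup
import HarnessLib

/-!
# The Schochet–ALSS two-pole solution is a CLASSICAL DECAYING solution: envelopes `C/(1+x²)` on `[0, T₁]`, `T₁ < T`

HONEST FRAMING (cell ns-blowup GROUP B «PROFILE SEARCH», zone Z3, rows Z3-U (A-F2) / Z3-E12⁻ (clause (i′)) of
`HOME/profile/z3/CENSUS-Z3.md`; human rulings D-0035/D-0074): **1-D MODEL (the viscous Constantin–Lax–Majda equation
`ω_t = ω·Hω + ν ω_xx` on `ℝ`, genuine `hilbertTransform`); not Euler, not Navier–Stokes; «violates: none — MODEL».**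

CONTENT. Pointwise envelopes of the building blocks of the two-pole profile (`inv_sq_add_le_env`, `abs_fx_le`, `abs_gx_le`,
`abs_fxx_le`, `abs_gxx_le`, `H_blocks_le`) and of the solution family of `SheetNSLineSchochetTwoPoleSolution.lean` wherever
`y(t) ≥ m > 0` and `s(t) ≥ s₀ > 0` (`env_omega`, `env_omegax`, `env_omegaxx`, `env_H`):
`|ω| ≤ 24(k+1)ν(1+m⁻²)/(1+x²)`, `|ωₓ| ≤ (48kν/s₀ + 144ν/m)(1+m⁻²)/(1+x²)`, `|ωₓₓ| ≤ (144kν/(s₀m) + 288ν/m²)(1+m⁻²)/(1+x²)`,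
`|Hω| ≤ 48kν/(s₀m) + 24ν/m²`. These are exactly the hypotheses of the uniqueness theorem
`SheetNSLineViscousCLMUnique.viscousCLM_line_unique` on every `[0, T₁]`, `T₁ < T` (there `y ≥ y(T₁) > 0`, `s ≥ s₀`); the corollary
«EVERY classical decaying solution from the small Schochet datum has lifespan `≤ T`» is assembled in
`SheetNSLineSchochetTwoPoleUnique.lean`. WHAT IS NOT HERE: anything about Navier–Stokes. No definitions, no named facts.
bears_on: LADDER-NS N5 / zone Z3 → N1 linear core.
-/

noncomputable section

namespace Summit.NavierStokesRegularity.OSWSelfSimilar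
namespace SheetNSLineSchochetTwoPole

open _root_.MeasureTheory Set Filter Literature.Analysis.Fourier
open scoped Real Topology

/-! ### Envelopes of the building blocks (`L > 0`) -/

/-- `(x² + L²)⁻¹ ≤ (1 + 1/m²)/(1 + x²)` for `L ≥ m > 0`. [folklore] -/
theorem inv_sq_add_le_env {m L : ℝ} (hm : 0 < m) (hmL : m ≤ L) (x : ℝ) :
    (x ^ 2 + L ^ 2)⁻¹ ≤ (1 + 1 / m ^ 2) / (1 + x ^ 2) := by
  have hL : 0 < L := hm.trans_le hmL
  rw [inv_eq_one_div, div_le_div_iff₀ (by positivity) (by positivity)]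
  have h1 : m ^ 2 ≤ L ^ 2 := pow_le_pow_left₀ hm.le hmL 2
  have h2 : 1 ≤ L ^ 2 / m ^ 2 := by rw [le_div_iff₀ (by positivity)]; linarith
  have h3 : 0 ≤ x ^ 2 / m ^ 2 := by positivity
  have e : (1 + 1 / m ^ 2) * (x ^ 2 + L ^ 2) = x ^ 2 + L ^ 2 + x ^ 2 / m ^ 2 + L ^ 2 / m ^ 2 := by ring
  rw [e]
  nlinarith [sq_nonneg L, sq_nonneg x]

/-- `|(L² − x²)/(x²+L²)²| ≤ (x²+L²)⁻¹`. [folklore] -/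
theorem abs_fx_le {L : ℝ} (hL : 0 < L) (x : ℝ) : |(L ^ 2 - x ^ 2) / (x ^ 2 + L ^ 2) ^ 2| ≤ (x ^ 2 + L ^ 2)⁻¹ := by
  have hD : (0:ℝ) < x ^ 2 + L ^ 2 := by positivity
  rw [abs_div, abs_of_pos (by positivity : (0:ℝ) < (x ^ 2 + L ^ 2) ^ 2), inv_eq_one_div,
    div_le_div_iff₀ (by positivity) hD]
  have h1 : |L ^ 2 - x ^ 2| ≤ x ^ 2 + L ^ 2 := abs_le.2 ⟨by nlinarith, by nlinarith⟩
  nlinarith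

/-- `|2L(L² − 3x²)/(x²+L²)³| ≤ 6/(L(x²+L²))`. [folklore] -/
theorem abs_gx_le {L : ℝ} (hL : 0 < L) (x : ℝ) :
    |2 * L * (L ^ 2 - 3 * x ^ 2) / (x ^ 2 + L ^ 2) ^ 3| ≤ 6 / (L * (x ^ 2 + L ^ 2)) := by
  have hD : (0:ℝ) < x ^ 2 + L ^ 2 := by positivity
  rw [abs_div, abs_of_pos (by positivity : (0:ℝ) < (x ^ 2 + L ^ 2) ^ 3), div_le_div_iff₀ (by positivity) (by positivity),
    abs_mul, abs_of_pos (by positivity : (0:ℝ) < 2 * L)]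
  have h1 : |L ^ 2 - 3 * x ^ 2| ≤ 3 * (x ^ 2 + L ^ 2) := abs_le.2 ⟨by nlinarith, by nlinarith⟩
  have h2 : L ^ 2 ≤ x ^ 2 + L ^ 2 := by nlinarith
  calc 2 * L * |L ^ 2 - 3 * x ^ 2| * (L * (x ^ 2 + L ^ 2))
      ≤ 2 * L * (3 * (x ^ 2 + L ^ 2)) * (L * (x ^ 2 + L ^ 2)) := by gcongr
    _ = 6 * (L ^ 2 * (x ^ 2 + L ^ 2) ^ 2) := by ring
    _ ≤ 6 * ((x ^ 2 + L ^ 2) * (x ^ 2 + L ^ 2) ^ 2) := by gcongr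
    _ = 6 * (x ^ 2 + L ^ 2) ^ 3 := by ring

/-- `|2x(x² − 3L²)/(x²+L²)³| ≤ 3/(L(x²+L²))`. [folklore] -/
theorem abs_fxx_le {L : ℝ} (hL : 0 < L) (x : ℝ) :
    |2 * x * (x ^ 2 - 3 * L ^ 2) / (x ^ 2 + L ^ 2) ^ 3| ≤ 3 / (L * (x ^ 2 + L ^ 2)) := by
  have hD : (0:ℝ) < x ^ 2 + L ^ 2 := by positivity
  rw [abs_div, abs_of_pos (by positivity : (0:ℝ) < (x ^ 2 + L ^ 2) ^ 3), div_le_div_iff₀ (by positivity) (by positivity),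
    abs_mul, abs_mul, abs_two]
  have h1 : |x ^ 2 - 3 * L ^ 2| ≤ 3 * (x ^ 2 + L ^ 2) := abs_le.2 ⟨by nlinarith, by nlinarith⟩
  have h2 : 2 * L * |x| ≤ x ^ 2 + L ^ 2 := by nlinarith [sq_nonneg (|x| - L), sq_abs x]
  calc 2 * |x| * |x ^ 2 - 3 * L ^ 2| * (L * (x ^ 2 + L ^ 2))
      ≤ 2 * |x| * (3 * (x ^ 2 + L ^ 2)) * (L * (x ^ 2 + L ^ 2)) := by gcongr
    _ = 3 * ((2 * L * |x|) * (x ^ 2 + L ^ 2) ^ 2) := by ring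
    _ ≤ 3 * ((x ^ 2 + L ^ 2) * (x ^ 2 + L ^ 2) ^ 2) := by gcongr
    _ = 3 * (x ^ 2 + L ^ 2) ^ 3 := by ring

/-- `|24Lx(x² − L²)/(x²+L²)⁴| ≤ 12/(L²(x²+L²))`. [folklore] -/
theorem abs_gxx_le {L : ℝ} (hL : 0 < L) (x : ℝ) :
    |24 * L * x * (x ^ 2 - L ^ 2) / (x ^ 2 + L ^ 2) ^ 4| ≤ 12 / (L ^ 2 * (x ^ 2 + L ^ 2)) := by
  have hD : (0:ℝ) < x ^ 2 + L ^ 2 := by positivity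
  rw [abs_div, abs_of_pos (by positivity : (0:ℝ) < (x ^ 2 + L ^ 2) ^ 4), div_le_div_iff₀ (by positivity) (by positivity),
    abs_mul, abs_mul, abs_of_pos (by positivity : (0:ℝ) < 24 * L)]
  have h1 : |x ^ 2 - L ^ 2| ≤ x ^ 2 + L ^ 2 := abs_le.2 ⟨by nlinarith, by nlinarith⟩
  have h2 : 2 * L * |x| ≤ x ^ 2 + L ^ 2 := by nlinarith [sq_nonneg (|x| - L), sq_abs x]
  have h3 : L ^ 2 ≤ x ^ 2 + L ^ 2 := by nlinarith
  calc 24 * L * |x| * |x ^ 2 - L ^ 2| * (L ^ 2 * (x ^ 2 + L ^ 2))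
      ≤ 24 * L * |x| * (x ^ 2 + L ^ 2) * (L ^ 2 * (x ^ 2 + L ^ 2)) := by gcongr
    _ = 12 * ((2 * L * |x|) * L ^ 2 * (x ^ 2 + L ^ 2) ^ 2) := by ring
    _ ≤ 12 * ((x ^ 2 + L ^ 2) * (x ^ 2 + L ^ 2) * (x ^ 2 + L ^ 2) ^ 2) := by gcongr
    _ = 12 * (x ^ 2 + L ^ 2) ^ 4 := by ring

/-- `L/(x²+L²) ≤ 1/L` and `|(L²−x²)/(x²+L²)²| ≤ 1/L²` (the `H`-side blocks). [folklore] -/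
theorem H_blocks_le {L : ℝ} (hL : 0 < L) (x : ℝ) :
    |L / (x ^ 2 + L ^ 2)| ≤ 1 / L ∧ |(L ^ 2 - x ^ 2) / (x ^ 2 + L ^ 2) ^ 2| ≤ 1 / L ^ 2 := by
  have hD : (0:ℝ) < x ^ 2 + L ^ 2 := by positivity
  have hinv : (x ^ 2 + L ^ 2)⁻¹ ≤ 1 / L ^ 2 := by
    rw [inv_eq_one_div]
    exact one_div_le_one_div_of_le (by positivity) (by nlinarith)
  refine ⟨?_, (abs_fx_le hL x).trans hinv⟩
  rw [abs_of_pos (by positivity), div_le_div_iff₀ hD hL]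
  nlinarith

/-! ### Envelopes of the solution family on `y(t) ≥ m > 0`, `s(t) ≥ s₀ > 0` -/

section Envelope

variable {ν k : ℝ} {s y : ℝ → ℝ} {ω ωx ωxx : ℝ → ℝ → ℝ}

/-- Amplitude bound `|−24kν/s(t)| ≤ 24kν/s₀` for `s(t) ≥ s₀ > 0`. [folklore] -/
theorem abs_amp_le (hν : 0 < ν) (hk0 : 0 < k) {s₀ st : ℝ} (hs₀ : 0 < s₀) (hss : s₀ ≤ st) :
    |(-24 * k * ν / st)| ≤ 24 * k * ν / s₀ := by
  have hst : 0 < st := hs₀.trans_le hss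
  rw [abs_of_neg (div_neg_of_neg_of_pos (by nlinarith [mul_pos hk0 hν]) hst), show -(-24 * k * ν / st) = 24 * k * ν / st by ring]
  exact div_le_div_of_nonneg_left (by positivity) hs₀ hss

/-- Envelope of `ω`: `|ω(t,x)| ≤ 24(k+1)ν(1 + 1/m²)/(1+x²)`. [folklore] -/
theorem env_omega (hν : 0 < ν) (hk0 : 0 < k)
    (hω : ∀ t x, ω t x = (-24 * k * ν / s t) * (x / (x ^ 2 + y t ^ 2) - x / (x ^ 2 + (y t + s t) ^ 2))
      + (-12 * ν) * (2 * y t * x / (x ^ 2 + y t ^ 2) ^ 2 + 2 * (y t + s t) * x / (x ^ 2 + (y t + s t) ^ 2) ^ 2))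
    {t m : ℝ} (hm : 0 < m) (hmy : m ≤ y t) (hst : 0 < s t) (x : ℝ) :
    |ω t x| ≤ 24 * (k + 1) * ν * (1 + 1 / m ^ 2) / (1 + x ^ 2) := by
  have hy1 : 0 < y t := hm.trans_le hmy
  have h := solution_abs_le_lorentzian hν hk0 hω hy1 hst x
  have hP := inv_sq_add_le_env hm hmy x
  calc |ω t x| ≤ 24 * (k + 1) * ν * (x ^ 2 + y t ^ 2)⁻¹ := h
    _ ≤ 24 * (k + 1) * ν * ((1 + 1 / m ^ 2) / (1 + x ^ 2)) := by gcongr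
    _ = 24 * (k + 1) * ν * (1 + 1 / m ^ 2) / (1 + x ^ 2) := by ring

/-- Envelope of `ωₓ`: `|ωₓ(t,x)| ≤ (48kν/s₀ + 144ν/m)(1 + 1/m²)/(1+x²)`. [folklore] -/
theorem env_omegax (hν : 0 < ν) (hk0 : 0 < k)
    (hωx : ∀ t x, ωx t x = (-24 * k * ν / s t) * ((y t ^ 2 - x ^ 2) / (x ^ 2 + y t ^ 2) ^ 2
        - ((y t + s t) ^ 2 - x ^ 2) / (x ^ 2 + (y t + s t) ^ 2) ^ 2)
      + (-12 * ν) * (2 * y t * (y t ^ 2 - 3 * x ^ 2) / (x ^ 2 + y t ^ 2) ^ 3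
        + 2 * (y t + s t) * ((y t + s t) ^ 2 - 3 * x ^ 2) / (x ^ 2 + (y t + s t) ^ 2) ^ 3))
    {t m s₀ : ℝ} (hm : 0 < m) (hmy : m ≤ y t) (hs₀ : 0 < s₀) (hss : s₀ ≤ s t) (x : ℝ) :
    |ωx t x| ≤ (2 * (24 * k * ν / s₀) + 144 * ν / m) * (1 + 1 / m ^ 2) / (1 + x ^ 2) := by
  rw [hωx]
  have hy1 : 0 < y t := hm.trans_le hmy
  have hst : 0 < s t := hs₀.trans_le hss
  have hy2 : 0 < y t + s t := by linarith
  set P := (x ^ 2 + y t ^ 2)⁻¹ with hP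
  have hP0 : 0 ≤ P := by positivity
  have hPenv : P ≤ (1 + 1 / m ^ 2) / (1 + x ^ 2) := inv_sq_add_le_env hm hmy x
  have hP2 : (x ^ 2 + (y t + s t) ^ 2)⁻¹ ≤ P := by
    apply inv_anti₀ (by positivity)
    nlinarith
  have ha := abs_amp_le hν hk0 hs₀ hss
  have hb : |(-12 * ν : ℝ)| = 12 * ν := by rw [abs_of_neg (by linarith)]; ring
  have hym : 6 / y t ≤ 6 / m := div_le_div_of_nonneg_left (by norm_num) hm hmy
  have hym2 : 6 / (y t + s t) ≤ 6 / m := div_le_div_of_nonneg_left (by norm_num) hm (by linarith)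
  have t1 : |(y t ^ 2 - x ^ 2) / (x ^ 2 + y t ^ 2) ^ 2| ≤ P := abs_fx_le hy1 x
  have t2 : |((y t + s t) ^ 2 - x ^ 2) / (x ^ 2 + (y t + s t) ^ 2) ^ 2| ≤ P := (abs_fx_le hy2 x).trans hP2
  have t3 : |2 * y t * (y t ^ 2 - 3 * x ^ 2) / (x ^ 2 + y t ^ 2) ^ 3| ≤ 6 / m * P := by
    refine (abs_gx_le hy1 x).trans ?_
    rw [show 6 / (y t * (x ^ 2 + y t ^ 2)) = 6 / y t * P by rw [hP, ← div_eq_mul_inv, div_div]]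
    exact mul_le_mul_of_nonneg_right hym hP0
  have t4 : |2 * (y t + s t) * ((y t + s t) ^ 2 - 3 * x ^ 2) / (x ^ 2 + (y t + s t) ^ 2) ^ 3| ≤ 6 / m * P := by
    refine (abs_gx_le hy2 x).trans ?_
    rw [show 6 / ((y t + s t) * (x ^ 2 + (y t + s t) ^ 2)) = 6 / (y t + s t) * (x ^ 2 + (y t + s t) ^ 2)⁻¹ by
      rw [← div_eq_mul_inv, div_div]]
    exact mul_le_mul hym2 hP2 (by positivity) (by positivity)
  calc |(-24 * k * ν / s t) * ((y t ^ 2 - x ^ 2) / (x ^ 2 + y t ^ 2) ^ 2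
          - ((y t + s t) ^ 2 - x ^ 2) / (x ^ 2 + (y t + s t) ^ 2) ^ 2)
        + (-12 * ν) * (2 * y t * (y t ^ 2 - 3 * x ^ 2) / (x ^ 2 + y t ^ 2) ^ 3
          + 2 * (y t + s t) * ((y t + s t) ^ 2 - 3 * x ^ 2) / (x ^ 2 + (y t + s t) ^ 2) ^ 3)|
      ≤ |(-24 * k * ν / s t)| * (|(y t ^ 2 - x ^ 2) / (x ^ 2 + y t ^ 2) ^ 2|
            + |((y t + s t) ^ 2 - x ^ 2) / (x ^ 2 + (y t + s t) ^ 2) ^ 2|)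
        + |(-12 * ν : ℝ)| * (|2 * y t * (y t ^ 2 - 3 * x ^ 2) / (x ^ 2 + y t ^ 2) ^ 3|
            + |2 * (y t + s t) * ((y t + s t) ^ 2 - 3 * x ^ 2) / (x ^ 2 + (y t + s t) ^ 2) ^ 3|) := by
        refine (abs_add_le _ _).trans (add_le_add ?_ ?_)
        · rw [abs_mul]; exact mul_le_mul_of_nonneg_left (abs_sub _ _) (abs_nonneg _)
        · rw [abs_mul]; exact mul_le_mul_of_nonneg_left (abs_add_le _ _) (abs_nonneg _)
    _ ≤ (24 * k * ν / s₀) * (P + P) + (12 * ν) * (6 / m * P + 6 / m * P) := by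
        rw [hb]
        gcongr
    _ = (2 * (24 * k * ν / s₀) + 144 * ν / m) * P := by ring
    _ ≤ (2 * (24 * k * ν / s₀) + 144 * ν / m) * ((1 + 1 / m ^ 2) / (1 + x ^ 2)) :=
        mul_le_mul_of_nonneg_left hPenv (by positivity)
    _ = (2 * (24 * k * ν / s₀) + 144 * ν / m) * (1 + 1 / m ^ 2) / (1 + x ^ 2) := by ring

/-- Envelope of `ωₓₓ`: `|ωₓₓ(t,x)| ≤ (144kν/(s₀m) + 288ν/m²)(1 + 1/m²)/(1+x²)`. [folklore] -/
theorem env_omegaxx (hν : 0 < ν) (hk0 : 0 < k)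
    (hωxx : ∀ t x, ωxx t x = (-24 * k * ν / s t) * (2 * x * (x ^ 2 - 3 * y t ^ 2) / (x ^ 2 + y t ^ 2) ^ 3
        - 2 * x * (x ^ 2 - 3 * (y t + s t) ^ 2) / (x ^ 2 + (y t + s t) ^ 2) ^ 3)
      + (-12 * ν) * (24 * y t * x * (x ^ 2 - y t ^ 2) / (x ^ 2 + y t ^ 2) ^ 4
        + 24 * (y t + s t) * x * (x ^ 2 - (y t + s t) ^ 2) / (x ^ 2 + (y t + s t) ^ 2) ^ 4))
    {t m s₀ : ℝ} (hm : 0 < m) (hmy : m ≤ y t) (hs₀ : 0 < s₀) (hss : s₀ ≤ s t) (x : ℝ) :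
    |ωxx t x| ≤ (2 * (24 * k * ν / s₀) * (3 / m) + 24 * ν * (12 / m ^ 2)) * (1 + 1 / m ^ 2) / (1 + x ^ 2) := by
  rw [hωxx]
  have hy1 : 0 < y t := hm.trans_le hmy
  have hst : 0 < s t := hs₀.trans_le hss
  have hy2 : 0 < y t + s t := by linarith
  set P := (x ^ 2 + y t ^ 2)⁻¹ with hP
  have hP0 : 0 ≤ P := by positivity
  have hPenv : P ≤ (1 + 1 / m ^ 2) / (1 + x ^ 2) := inv_sq_add_le_env hm hmy x
  have hP2 : (x ^ 2 + (y t + s t) ^ 2)⁻¹ ≤ P := by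
    apply inv_anti₀ (by positivity)
    nlinarith
  have ha := abs_amp_le hν hk0 hs₀ hss
  have hb : |(-12 * ν : ℝ)| = 12 * ν := by rw [abs_of_neg (by linarith)]; ring
  have hym : 3 / y t ≤ 3 / m := div_le_div_of_nonneg_left (by norm_num) hm hmy
  have hym2 : 3 / (y t + s t) ≤ 3 / m := div_le_div_of_nonneg_left (by norm_num) hm (by linarith)
  have hymm : 12 / y t ^ 2 ≤ 12 / m ^ 2 :=
    div_le_div_of_nonneg_left (by norm_num) (by positivity) (pow_le_pow_left₀ hm.le hmy 2)
  have hymm2 : 12 / (y t + s t) ^ 2 ≤ 12 / m ^ 2 :=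
    div_le_div_of_nonneg_left (by norm_num) (by positivity) (pow_le_pow_left₀ hm.le (by linarith) 2)
  have t1 : |2 * x * (x ^ 2 - 3 * y t ^ 2) / (x ^ 2 + y t ^ 2) ^ 3| ≤ 3 / m * P := by
    refine (abs_fxx_le hy1 x).trans ?_
    rw [show 3 / (y t * (x ^ 2 + y t ^ 2)) = 3 / y t * P by rw [hP, ← div_eq_mul_inv, div_div]]
    exact mul_le_mul_of_nonneg_right hym hP0
  have t2 : |2 * x * (x ^ 2 - 3 * (y t + s t) ^ 2) / (x ^ 2 + (y t + s t) ^ 2) ^ 3| ≤ 3 / m * P := by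
    refine (abs_fxx_le hy2 x).trans ?_
    rw [show 3 / ((y t + s t) * (x ^ 2 + (y t + s t) ^ 2)) = 3 / (y t + s t) * (x ^ 2 + (y t + s t) ^ 2)⁻¹ by
      rw [← div_eq_mul_inv, div_div]]
    exact mul_le_mul hym2 hP2 (by positivity) (by positivity)
  have t3 : |24 * y t * x * (x ^ 2 - y t ^ 2) / (x ^ 2 + y t ^ 2) ^ 4| ≤ 12 / m ^ 2 * P := by
    refine (abs_gxx_le hy1 x).trans ?_
    rw [show 12 / (y t ^ 2 * (x ^ 2 + y t ^ 2)) = 12 / y t ^ 2 * P by rw [hP, ← div_eq_mul_inv, div_div]]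
    exact mul_le_mul_of_nonneg_right hymm hP0
  have t4 : |24 * (y t + s t) * x * (x ^ 2 - (y t + s t) ^ 2) / (x ^ 2 + (y t + s t) ^ 2) ^ 4| ≤ 12 / m ^ 2 * P := by
    refine (abs_gxx_le hy2 x).trans ?_
    rw [show 12 / ((y t + s t) ^ 2 * (x ^ 2 + (y t + s t) ^ 2)) = 12 / (y t + s t) ^ 2 * (x ^ 2 + (y t + s t) ^ 2)⁻¹ by
      rw [← div_eq_mul_inv, div_div]]
    exact mul_le_mul hymm2 hP2 (by positivity) (by positivity)
  calc |(-24 * k * ν / s t) * (2 * x * (x ^ 2 - 3 * y t ^ 2) / (x ^ 2 + y t ^ 2) ^ 3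
          - 2 * x * (x ^ 2 - 3 * (y t + s t) ^ 2) / (x ^ 2 + (y t + s t) ^ 2) ^ 3)
        + (-12 * ν) * (24 * y t * x * (x ^ 2 - y t ^ 2) / (x ^ 2 + y t ^ 2) ^ 4
          + 24 * (y t + s t) * x * (x ^ 2 - (y t + s t) ^ 2) / (x ^ 2 + (y t + s t) ^ 2) ^ 4)|
      ≤ |(-24 * k * ν / s t)| * (|2 * x * (x ^ 2 - 3 * y t ^ 2) / (x ^ 2 + y t ^ 2) ^ 3|
            + |2 * x * (x ^ 2 - 3 * (y t + s t) ^ 2) / (x ^ 2 + (y t + s t) ^ 2) ^ 3|)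
        + |(-12 * ν : ℝ)| * (|24 * y t * x * (x ^ 2 - y t ^ 2) / (x ^ 2 + y t ^ 2) ^ 4|
            + |24 * (y t + s t) * x * (x ^ 2 - (y t + s t) ^ 2) / (x ^ 2 + (y t + s t) ^ 2) ^ 4|) := by
        refine (abs_add_le _ _).trans (add_le_add ?_ ?_)
        · rw [abs_mul]; exact mul_le_mul_of_nonneg_left (abs_sub _ _) (abs_nonneg _)
        · rw [abs_mul]; exact mul_le_mul_of_nonneg_left (abs_add_le _ _) (abs_nonneg _)
    _ ≤ (24 * k * ν / s₀) * (3 / m * P + 3 / m * P) + (12 * ν) * (12 / m ^ 2 * P + 12 / m ^ 2 * P) := by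
        rw [hb]
        gcongr
    _ = (2 * (24 * k * ν / s₀) * (3 / m) + 24 * ν * (12 / m ^ 2)) * P := by ring
    _ ≤ (2 * (24 * k * ν / s₀) * (3 / m) + 24 * ν * (12 / m ^ 2)) * ((1 + 1 / m ^ 2) / (1 + x ^ 2)) :=
        mul_le_mul_of_nonneg_left hPenv (by positivity)
    _ = (2 * (24 * k * ν / s₀) * (3 / m) + 24 * ν * (12 / m ^ 2)) * (1 + 1 / m ^ 2) / (1 + x ^ 2) := by ring

/-- Envelope of `Hω`: `|H[ω(t,·)](x)| ≤ 48kν/(s₀ m) + 24ν/m²` (closed form of `hilbertTransform_solution`). [folklore] -/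
theorem env_H (hν : 0 < ν) (hk0 : 0 < k)
    (hω : ∀ t x, ω t x = (-24 * k * ν / s t) * (x / (x ^ 2 + y t ^ 2) - x / (x ^ 2 + (y t + s t) ^ 2))
      + (-12 * ν) * (2 * y t * x / (x ^ 2 + y t ^ 2) ^ 2 + 2 * (y t + s t) * x / (x ^ 2 + (y t + s t) ^ 2) ^ 2))
    {t m s₀ : ℝ} (hm : 0 < m) (hmy : m ≤ y t) (hs₀ : 0 < s₀) (hss : s₀ ≤ s t) (x : ℝ) :
    |hilbertTransform (ω t) x| ≤ 2 * (24 * k * ν / s₀) * (1 / m) + 24 * ν * (1 / m ^ 2) := by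
  have hy1 : 0 < y t := hm.trans_le hmy
  have hst : 0 < s t := hs₀.trans_le hss
  have hy2 : 0 < y t + s t := by linarith
  rw [hilbertTransform_solution hω hy1 hst x]
  have ha := abs_amp_le hν hk0 hs₀ hss
  have hb : |(-12 * ν : ℝ)| = 12 * ν := by rw [abs_of_neg (by linarith)]; ring
  obtain ⟨p1, q1⟩ := H_blocks_le hy1 x
  obtain ⟨p2, q2⟩ := H_blocks_le hy2 x
  have r1 : 1 / y t ≤ 1 / m := one_div_le_one_div_of_le hm hmy
  have r2 : 1 / (y t + s t) ≤ 1 / m := one_div_le_one_div_of_le hm (by linarith)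
  have r3 : 1 / y t ^ 2 ≤ 1 / m ^ 2 := one_div_le_one_div_of_le (by positivity) (pow_le_pow_left₀ hm.le hmy 2)
  have r4 : 1 / (y t + s t) ^ 2 ≤ 1 / m ^ 2 :=
    one_div_le_one_div_of_le (by positivity) (pow_le_pow_left₀ hm.le (by linarith) 2)
  calc |-((-24 * k * ν / s t) * (y t / (x ^ 2 + y t ^ 2) - (y t + s t) / (x ^ 2 + (y t + s t) ^ 2)))
        - (-12 * ν) * ((y t ^ 2 - x ^ 2) / (x ^ 2 + y t ^ 2) ^ 2 + ((y t + s t) ^ 2 - x ^ 2) / (x ^ 2 + (y t + s t) ^ 2) ^ 2)|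
      ≤ |(-24 * k * ν / s t)| * (|y t / (x ^ 2 + y t ^ 2)| + |(y t + s t) / (x ^ 2 + (y t + s t) ^ 2)|)
        + |(-12 * ν : ℝ)| * (|(y t ^ 2 - x ^ 2) / (x ^ 2 + y t ^ 2) ^ 2|
            + |((y t + s t) ^ 2 - x ^ 2) / (x ^ 2 + (y t + s t) ^ 2) ^ 2|) := by
        refine (abs_sub _ _).trans (add_le_add ?_ ?_)
        · rw [abs_neg, abs_mul]; exact mul_le_mul_of_nonneg_left (abs_sub _ _) (abs_nonneg _)
        · rw [abs_mul]; exact mul_le_mul_of_nonneg_left (abs_add_le _ _) (abs_nonneg _)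
    _ ≤ (24 * k * ν / s₀) * (1 / m + 1 / m) + (12 * ν) * (1 / m ^ 2 + 1 / m ^ 2) := by
        rw [hb]
        gcongr
        · exact p1.trans r1
        · exact p2.trans r2
        · exact q1.trans r3
        · exact q2.trans r4
    _ = 2 * (24 * k * ν / s₀) * (1 / m) + 24 * ν * (1 / m ^ 2) := by ring

end Envelope

end SheetNSLineSchochetTwoPole
end Summit.NavierStokesRegularity.OSWSelfSimilar

end
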